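import Summits.Ventures.PercRepro.RankDistUpSetGirth

/-!
# PercRepro — THE DUAL OF THEOREM G: the nullity levels dominate the upper binomial coefficients up to the cogirth
(p9, gen 21)

Theorem G (`choose_le_levelCount_of_girth`) says `C(n, u) ≤ c_u = #{A ⊆ E : ρ(A) = u}` for `2u ≤ ρ(E) + girth`.
Applied to the dual matroid `M✶` (rank `q = n − p`, girth = the cogirth of `M`) it reads
`C(n, u) ≤ #{A ⊆ E : ρ✶(A) = u}` for `2u ≤ q + cogirth`; and `ρ✶(A) = u` means, for `C = E ∖ A`, that the NULLITY
`|C| − ρ(C)` equals `q − u` (`eRk_dual_add_eRank`: `ρ✶(A) + p = ρ(E ∖ A) + |A|`), so with `j = q − u`: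
**`#{C ⊆ E : |C| − ρ(C) = j} ≥ C(n, p + j)` for every `j ≤ q` with `q ≤ 2j + cogirth`**
(`choose_le_nullityCount_of_cogirth`; `levelCount_dual_eq_nullityCount`). The two statements are mirror images:
the rank levels dominate `C(n, u)` up to half of `p + girth`, the nullity levels dominate `C(n, p + j)` from half of
`q − cogirth` on. Every matroid has cogirth `≥ 1`; the coloop-free ones `≥ 2`. Nothing here moves any window of the
crux.
-/

namespace PercRepro.RankDist

open Set Finset _root_.Matroid PercRepro.ThmH

variable {α : Type} (M : Matroid α) [M.Finite]

/-- `ν_j`: the number of subsets of `E` of nullity `j` (`|C| = ρ(C) + j`). -/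
noncomputable def nullityCount (j : ℕ) : ℕ := ((subsetsFin M).filter (fun C => C.ncard = rk M C + j)).card

/-- The ground finset of the dual is the ground finset. -/
lemma subsetsFin_dual : subsetsFin M✶ = subsetsFin M := by
  ext A
  rw [mem_subsetsFin, mem_subsetsFin, Matroid.dual_ground]

/-- The dual rank in natural numbers: `ρ✶(A) + p = ρ(E ∖ A) + |A|` for `A ⊆ E`. -/
lemma rk_dual_add_eq {p : ℕ} (hr : M.eRank = (p : ℕ∞)) {A : Set α} (hA : A ⊆ M.E) :
    rk M✶ A + p = rk M (M.E \ A) + A.ncard := by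
  have h := Matroid.eRk_dual_add_eRank M A hA
  have hfinA : A.Finite := M.ground_finite.subset hA
  rw [hr, eRk_eq_coe_rk M✶ (by rw [Matroid.dual_ground]; exact hA), eRk_eq_coe_rk M Set.sdiff_subset,
    hfinA.encard_eq_coe_toFinset_card, ← Set.ncard_eq_toFinset_card _ hfinA] at h
  exact_mod_cast h

/-- The rank of the dual is `n − p`. -/
lemma eRank_dual_eq {n p : ℕ} (hn : (gr M).card = n) (hr : M.eRank = (p : ℕ∞)) :
    M✶.eRank = ((n - p : ℕ) : ℕ∞) := by
  have h := Matroid.eRank_add_eRank_dual M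
  rw [hr, ← coe_gr, Set.encard_coe_eq_coe_finsetCard, hn] at h
  have hle : p ≤ n := by
    have h' : (p : ℕ∞) ≤ (n : ℕ∞) := by rw [← h]; exact le_self_add
    exact_mod_cast h'
  have h2 : ((p : ℕ) : ℕ∞) + M✶.eRank = ((p + (n - p) : ℕ) : ℕ∞) := by
    rw [h, Nat.add_sub_cancel' hle]
  rw [Nat.cast_add] at h2
  exact WithTop.add_left_cancel (WithTop.coe_ne_top) h2

/-- **The rank levels of the dual are the nullity levels**: `#{A : ρ✶(A) = u} = #{C : |C| − ρ(C) = q − u}` for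
`u ≤ q = n − p`, by `A ↦ E ∖ A`. -/
lemma levelCount_dual_eq_nullityCount {n p u : ℕ} (hn : (gr M).card = n) (hr : M.eRank = (p : ℕ∞))
    (hu : u ≤ n - p) : levelCount M✶ u = nullityCount M (n - p - u) := by
  classical
  have hpn : p ≤ n := by
    have h := Matroid.eRank_add_eRank_dual M
    rw [hr, ← coe_gr, Set.encard_coe_eq_coe_finsetCard, hn] at h
    have h' : (p : ℕ∞) ≤ (n : ℕ∞) := by rw [← h]; exact le_self_add
    exact_mod_cast h'
  unfold levelCount nullityCount
  rw [subsetsFin_dual]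
  refine Finset.card_bij (fun A _ => M.E \ A) (fun A hA => ?_) (fun A₁ hA₁ A₂ hA₂ h => ?_) (fun C hC => ?_)
  · rw [Finset.mem_filter, mem_subsetsFin] at hA
    rw [Finset.mem_filter, mem_subsetsFin]
    obtain ⟨hAE, hAu⟩ := hA
    have hfin : A.Finite := M.ground_finite.subset hAE
    have hd := rk_dual_add_eq M hr hAE
    have hc : (M.E \ A).ncard + A.ncard = n := by
      rw [Set.ncard_sdiff_add_ncard_of_subset hAE M.ground_finite, ← coe_gr, Set.ncard_coe_finset, hn]
    refine ⟨Set.sdiff_subset, ?_⟩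
    omega
  · rw [Finset.mem_filter, mem_subsetsFin] at hA₁ hA₂
    have h1 := congrArg (fun X => M.E \ X) h
    simp only [Set.sdiff_sdiff_cancel_left hA₁.1, Set.sdiff_sdiff_cancel_left hA₂.1] at h1
    exact h1
  · rw [Finset.mem_filter, mem_subsetsFin] at hC
    obtain ⟨hCE, hCj⟩ := hC
    refine ⟨M.E \ C, ?_, Set.sdiff_sdiff_cancel_left hCE⟩
    rw [Finset.mem_filter, mem_subsetsFin]
    have hd := rk_dual_add_eq M hr (A := M.E \ C) Set.sdiff_subset
    rw [Set.sdiff_sdiff_cancel_left hCE] at hd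
    have hc : (M.E \ C).ncard + C.ncard = n := by
      rw [Set.ncard_sdiff_add_ncard_of_subset hCE M.ground_finite, ← coe_gr, Set.ncard_coe_finset, hn]
    refine ⟨Set.sdiff_subset, ?_⟩
    omega

/-- **THE NULLITY LEVELS DOMINATE THE UPPER BINOMIAL COEFFICIENTS UP TO THE COGIRTH** (the dual of Theorem G): in a
finite matroid on `n` elements of rank `p` whose cocircuits all have at least `g` elements,
`C(n, p + j) ≤ #{C ⊆ E : |C| − ρ(C) = j}` for every `j ≤ n − p` with `n − p ≤ 2j + g`. -/
theorem choose_le_nullityCount_of_cogirth {n p g j : ℕ} (hn : (gr M).card = n) (hr : M.eRank = (p : ℕ∞))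
    (hg : ∀ K, M.IsCocircuit K → (g : ℕ∞) ≤ K.encard) (hj : j ≤ n - p) (h2 : n - p ≤ 2 * j + g) :
    n.choose (p + j) ≤ nullityCount M j := by
  classical
  have hpn : p ≤ n := by
    have h := Matroid.eRank_add_eRank_dual M
    rw [hr, ← coe_gr, Set.encard_coe_eq_coe_finsetCard, hn] at h
    have h' : (p : ℕ∞) ≤ (n : ℕ∞) := by rw [← h]; exact le_self_add
    exact_mod_cast h'
  have hr' := eRank_dual_eq M hn hr
  have hg' : ∀ C, M✶.IsCircuit C → (g : ℕ∞) ≤ C.encard := fun C hC => hg C (Matroid.isCocircuit_def.2 hC)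
  have hG := choose_le_levelCount_of_girth M✶ hr' hg' (u := n - p - j) (by omega) (by omega)
  have hgr : (gr M✶).card = n := hn
  rw [hgr, levelCount_dual_eq_nullityCount M hn hr (by omega)] at hG
  have hidx : n - p - (n - p - j) = j := by omega
  rw [hidx] at hG
  have hsymm : n.choose (p + j) = n.choose (n - p - j) := by
    rw [← Nat.choose_symm (by omega)]
    congr 1
    omega
  exact hsymm ▸ hG

end PercRepro.RankDist
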